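import Summits.NavierStokesRegularity.NavierStokesRegularity.Theorems.RellichScarScarRigidityApexRegularityKernel
import Mathlib.Analysis.Calculus.Taylor
import HarnessLib

/-!
# `ScarRigidity`, line `moment-conditioned-rellich` — stub `stub_paintedLadderHigher` (PL≥2), part 4:
# Taylor expansion of the Newtonian kernel about a far point, to every order

Crux stmt-NavierStokesRegularity-11717 (route RellichScar), helper file (`--supports`) for the registered stub
`stub_paintedLadderHigher`.  Pure harmonic analysis on `ℝ³` (no fluid mechanics): the pointwise input of the
multipole (far-field) expansion of Newtonian potentials `∫ Γ(x − y) h(y) dy`, `Γ = newtonKernel = −1/(4π|z|)`, to an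
ARBITRARY order `M` (Stein, *Singular integrals* III §3; the tree's `NewtonPotentialFarField` is the case `M = 0`):

* `exists_norm_iteratedFDeriv_newtonFar_scale_le` — all derivatives of the far kernel AT SCALE `c`,
  `‖Dᵐ Γ∞^{c,2c}(z)‖ ≤ K_m/‖z‖^{m+1}` for `‖z‖ ≥ 3c` (scaling of the tree's unit-scale bound); hence
  `exists_norm_iteratedFDeriv_newtonKernel_le` — **`‖DᵐΓ(z)‖ ≤ K_m/‖z‖^{m+1}` for `z ≠ 0`**;
* `taylor_segment` — Taylor's formula along the segment `s ↦ x − s y` for a smooth function on `ℝ³`: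
  `|φ(x − y) − Σ_{m ≤ M} (−1)ᵐ/m! Dᵐφ(x)(y,…,y)| ≤ (sup_{[x, x−y]} ‖D^{M+1}φ‖) ‖y‖^{M+1}/M!` (Mathlib's one-variable
  `taylor_mean_remainder_bound` and the chain rule `(d/ds)ᵐ φ(x − s y) = (−1)ᵐ Dᵐφ(x − s y)(y,…,y)`);
* `newtonKernel_taylor_remainder` — **`|Γ(x − y) − Σ_{m ≤ M} (−1)ᵐ/m! DᵐΓ(x)(y,…,y)| ≤ C_M ‖y‖^{M+1}/‖x‖^{M+2}`
  for `‖y‖ ≤ ‖x‖/2`** (Taylor for the smooth far kernel `Γ∞^{c,2c}`, `c = ‖x‖/8`, which is `Γ` on the segment).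
-/

noncomputable section

open Set Filter Function MeasureTheory Metric TopologicalSpace
open scoped Topology ContDiff
open Literature.Analysis.FluidPDE

set_option linter.dupNamespace false -- D-0017: `Summit.<S>.<S>.…` repeats the summit name by design

namespace Summit.NavierStokesRegularity.NavierStokesRegularity.Theorems.RellichScarScarRigidity

/-! ### All derivatives of the Newtonian kernel off the origin -/

/-- **All derivatives of the far kernel at scale `c`**: `‖Dᵐ Γ∞^{c,2c}(z)‖ ≤ K_m/‖z‖^{m+1}` for `‖z‖ ≥ 3c`, with `K_m`
independent of `c > 0` (`Γ∞^{c,2c} = c⁻¹Γ∞^{1,2}(c⁻¹·)` and the tree's unit-scale bound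
`exists_norm_iteratedFDeriv_newtonFar_le_far`). [folklore] -/
theorem exists_norm_iteratedFDeriv_newtonFar_scale_le (m : ℕ) :
    ∃ K : ℝ, 0 ≤ K ∧ ∀ (c : ℝ), 0 < c → ∀ z : EuclideanSpace ℝ (Fin 3), 3 * c ≤ ‖z‖ →
      ‖iteratedFDeriv ℝ m (newtonFar (c * 1) (c * 2)) z‖ ≤ K / ‖z‖ ^ (m + 1) := by
  obtain ⟨B, hB0, hB⟩ := exists_norm_iteratedFDeriv_newtonFar_le_far m
  refine ⟨B, hB0, fun c hc z hz => ?_⟩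
  have hΓ : ContDiff ℝ m (newtonFar (1 : ℝ) 2) := contDiff_newtonFar one_pos one_lt_two
  have hz0 : 0 < ‖z‖ := by nlinarith
  rw [newtonFar_scale' hc]
  have h := PineauVicol2026.norm_iteratedFDeriv_unzoom_le hΓ hc 0 z
  simp only [sub_zero] at h
  refine h.trans ?_
  have hcz : ‖c⁻¹ • z‖ = ‖z‖ / c := by
    rw [norm_smul, norm_inv, Real.norm_of_nonneg hc.le, div_eq_inv_mul]
  have h3 : 3 ≤ ‖c⁻¹ • z‖ := by rw [hcz, le_div_iff₀ hc]; linarith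
  calc c⁻¹ ^ (m + 1) * ‖iteratedFDeriv ℝ m (newtonFar 1 2) (c⁻¹ • z)‖
      ≤ c⁻¹ ^ (m + 1) * (B * (‖c⁻¹ • z‖ ^ (m + 1))⁻¹) := mul_le_mul_of_nonneg_left (hB _ h3) (by positivity)
    _ = B * (c⁻¹ ^ (m + 1) * c ^ (m + 1)) / ‖z‖ ^ (m + 1) := by rw [hcz, div_pow, inv_div]; ring
    _ = B / ‖z‖ ^ (m + 1) := by rw [inv_pow, inv_mul_cancel₀ (pow_ne_zero _ hc.ne'), mul_one]

/-- The far kernel at scale `c` and the Newtonian kernel have the same derivatives at points `‖z‖ > 2c`. [folklore] -/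
theorem iteratedFDeriv_newtonFar_scale_eq {c : ℝ} (hc : 0 < c) {z : EuclideanSpace ℝ (Fin 3)} (hz : 2 * c < ‖z‖)
    (m : ℕ) : iteratedFDeriv ℝ m (newtonFar (c * 1) (c * 2)) z = iteratedFDeriv ℝ m newtonKernel z :=
  ((newtonFar_eventuallyEq_newtonKernel (by positivity : (0 : ℝ) ≤ c * 1) (by linarith : c * 1 < c * 2)
    (by linarith : c * 2 < ‖z‖)).iteratedFDeriv ℝ m).eq_of_nhds

/-- **All derivatives of the Newtonian kernel off the origin**: `‖DᵐΓ(z)‖ ≤ K_m/‖z‖^{m+1}` for `z ≠ 0` (`Γ` is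
homogeneous of degree `−1`). [cite: GilbargTrudinger2001, (2.14)] -/
theorem exists_norm_iteratedFDeriv_newtonKernel_le (m : ℕ) :
    ∃ K : ℝ, 0 ≤ K ∧ ∀ z : EuclideanSpace ℝ (Fin 3), z ≠ 0 → ‖iteratedFDeriv ℝ m newtonKernel z‖ ≤ K / ‖z‖ ^ (m + 1) := by
  obtain ⟨K, hK0, hK⟩ := exists_norm_iteratedFDeriv_newtonFar_scale_le m
  refine ⟨K, hK0, fun z hz => ?_⟩
  have hz0 : 0 < ‖z‖ := norm_pos_iff.2 hz
  have h := hK (‖z‖ / 4) (by positivity) z (by linarith)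
  rwa [iteratedFDeriv_newtonFar_scale_eq (by positivity) (by linarith) m] at h

/-! ### Taylor's formula along a segment -/

section Taylor

variable {φ : EuclideanSpace ℝ (Fin 3) → ℝ}

/-- **The chain rule along a line**: `(d/ds)ᵐ φ(x − s y) = (−1)ᵐ Dᵐφ(x − s y)(y, …, y)` for smooth `φ`. [folklore] -/
theorem iteratedDeriv_comp_segment (hφ : ContDiff ℝ ∞ φ) (x y : EuclideanSpace ℝ (Fin 3)) (m : ℕ) (s : ℝ) :
    iteratedDeriv m (fun σ : ℝ => φ (x - σ • y)) s = (-1 : ℝ) ^ m * iteratedFDeriv ℝ m φ (x - s • y) (fun _ => y) := by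
  set L : ℝ →L[ℝ] EuclideanSpace ℝ (Fin 3) := ContinuousLinearMap.toSpanSingleton ℝ (-y) with hL
  set g : EuclideanSpace ℝ (Fin 3) → ℝ := fun z => φ (x + z) with hg_def
  have hg : ContDiff ℝ ∞ g := hφ.comp (contDiff_const.add contDiff_id)
  have eψ : (fun σ : ℝ => φ (x - σ • y)) = g ∘ L := by
    funext σ
    simp [hg_def, hL, ContinuousLinearMap.toSpanSingleton_apply, smul_neg, sub_eq_add_neg]
  have hm : ((m : ℕ∞) : WithTop ℕ∞) ≤ ∞ := by exact_mod_cast le_top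
  rw [iteratedDeriv_eq_iteratedFDeriv, eψ, L.iteratedFDeriv_comp_right hg s hm,
    ContinuousMultilinearMap.compContinuousLinearMap_apply]
  have hL1 : (fun _ : Fin m => L 1) = fun i : Fin m => (-1 : ℝ) • (fun _ : Fin m => y) i := by
    funext i; simp [hL, ContinuousLinearMap.toSpanSingleton_apply]
  have hxs : x + L s = x - s • y := by
    simp [hL, ContinuousLinearMap.toSpanSingleton_apply, smul_neg, sub_eq_add_neg]
  rw [hL1, ContinuousMultilinearMap.map_smul_univ, Fin.prod_const, hg_def, iteratedFDeriv_comp_add_left, hxs,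
    smul_eq_mul]

/-- **Taylor's formula along the segment `[x, x − y]`** for a smooth function on `ℝ³`: if
`‖D^{M+1}φ(x − s y)‖ ≤ D` for `s ∈ [0, 1]`, then
`|φ(x − y) − Σ_{m ≤ M} (−1)ᵐ/m! Dᵐφ(x)(y,…,y)| ≤ D ‖y‖^{M+1}/M!` (Mathlib's `taylor_mean_remainder_bound` for
`s ↦ φ(x − s y)` on `[0, 1]`). [folklore] -/
theorem taylor_segment (hφ : ContDiff ℝ ∞ φ) (M : ℕ) (x y : EuclideanSpace ℝ (Fin 3)) {D : ℝ}
    (hD : ∀ s ∈ Icc (0 : ℝ) 1, ‖iteratedFDeriv ℝ (M + 1) φ (x - s • y)‖ ≤ D) :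
    |φ (x - y) - ∑ m ∈ Finset.range (M + 1),
        (-1 : ℝ) ^ m / m.factorial * iteratedFDeriv ℝ m φ x (fun _ => y)| ≤ D * ‖y‖ ^ (M + 1) / M.factorial := by
  set ψ : ℝ → ℝ := fun σ => φ (x - σ • y) with hψ_def
  have hψ : ContDiff ℝ ∞ ψ := hφ.comp (contDiff_const.sub (contDiff_id.smul contDiff_const))
  have key : ∀ (m : ℕ) (s : ℝ), iteratedDeriv m ψ s = (-1 : ℝ) ^ m * iteratedFDeriv ℝ m φ (x - s • y) (fun _ => y) :=
    fun m s => iteratedDeriv_comp_segment hφ x y m s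
  have hU : UniqueDiffOn ℝ (Icc (0 : ℝ) 1) := uniqueDiffOn_Icc zero_lt_one
  have hwithin : ∀ (m : ℕ), ∀ s ∈ Icc (0 : ℝ) 1, iteratedDerivWithin m ψ (Icc 0 1) s = iteratedDeriv m ψ s :=
    fun m s hs => iteratedDerivWithin_eq_iteratedDeriv hU (hψ.contDiffAt.of_le (by exact_mod_cast le_top)) hs
  have hD0 : 0 ≤ D := (norm_nonneg _).trans (hD 0 (left_mem_Icc.2 zero_le_one))
  -- the uniform bound on the `(M+1)`-st derivative along the segment
  have hC : ∀ s ∈ Icc (0 : ℝ) 1, ‖iteratedDerivWithin (M + 1) ψ (Icc 0 1) s‖ ≤ D * ‖y‖ ^ (M + 1) := by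
    intro s hs
    rw [hwithin (M + 1) s hs, key, norm_mul, norm_pow, norm_neg, norm_one, one_pow, one_mul, Real.norm_eq_abs,
      ← Real.norm_eq_abs]
    calc ‖iteratedFDeriv ℝ (M + 1) φ (x - s • y) (fun _ => y)‖
        ≤ ‖iteratedFDeriv ℝ (M + 1) φ (x - s • y)‖ * ∏ _i : Fin (M + 1), ‖y‖ := ContinuousMultilinearMap.le_opNorm _ _
      _ ≤ D * ‖y‖ ^ (M + 1) := by
          rw [Fin.prod_const]
          exact mul_le_mul_of_nonneg_right (hD s hs) (by positivity)
  have hT := taylor_mean_remainder_bound (f := ψ) (a := 0) (b := 1) (x := 1) (n := M) zero_le_one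
    (hψ.contDiffOn.of_le (by exact_mod_cast le_top)) (right_mem_Icc.2 zero_le_one) hC
  -- identify the Taylor polynomial
  have hpoly : taylorWithinEval ψ M (Icc 0 1) 0 1 =
      ∑ m ∈ Finset.range (M + 1), (-1 : ℝ) ^ m / m.factorial * iteratedFDeriv ℝ m φ x (fun _ => y) := by
    rw [taylor_within_apply]
    refine Finset.sum_congr rfl fun m _ => ?_
    rw [hwithin m 0 (left_mem_Icc.2 zero_le_one), key]
    simp only [zero_smul, sub_zero, smul_eq_mul, one_pow, mul_one]
    ring
  have hψ1 : ψ 1 = φ (x - y) := by simp [hψ_def]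
  rw [hpoly, hψ1, Real.norm_eq_abs, sub_zero, one_pow, mul_one] at hT
  exact hT

end Taylor

/-! ### The Taylor remainder of the Newtonian kernel about a far point -/

/-- Points of the segment `[x, x − y]` with `‖y‖ ≤ ‖x‖/2` have norm at least `‖x‖/2`. [folklore] -/
theorem half_norm_le_norm_sub_smul {x y : EuclideanSpace ℝ (Fin 3)} (hy : ‖y‖ ≤ ‖x‖ / 2) {s : ℝ} (hs : s ∈ Icc (0 : ℝ) 1) :
    ‖x‖ / 2 ≤ ‖x - s • y‖ := by
  have h1 : ‖x‖ - ‖s • y‖ ≤ ‖x - s • y‖ := norm_sub_norm_le x (s • y)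
  have h2 : ‖s • y‖ ≤ ‖y‖ := by
    rw [norm_smul, Real.norm_of_nonneg hs.1]
    exact mul_le_of_le_one_left (norm_nonneg _) hs.2
  linarith

/-- **The Taylor remainder of the Newtonian kernel about a far point, to every order**: for `x ≠ 0` and
`‖y‖ ≤ ‖x‖/2`, `|Γ(x − y) − Σ_{m ≤ M} (−1)ᵐ/m! DᵐΓ(x)(y,…,y)| ≤ C_M ‖y‖^{M+1}/‖x‖^{M+2}` (Taylor along the segment for
the smooth far kernel `Γ∞^{c,2c}`, `c = ‖x‖/8`, which coincides with `Γ` near the segment, where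
`‖D^{M+1}Γ‖ ≤ K_{M+1}(‖x‖/2)^{−(M+2)}`). [cite: GilbargTrudinger2001, (2.14)] -/
theorem newtonKernel_taylor_remainder (M : ℕ) :
    ∃ C : ℝ, 0 ≤ C ∧ ∀ (x y : EuclideanSpace ℝ (Fin 3)), x ≠ 0 → ‖y‖ ≤ ‖x‖ / 2 →
      |newtonKernel (x - y) - ∑ m ∈ Finset.range (M + 1),
          (-1 : ℝ) ^ m / m.factorial * iteratedFDeriv ℝ m newtonKernel x (fun _ => y)| ≤
        C * ‖y‖ ^ (M + 1) / ‖x‖ ^ (M + 2) := by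
  obtain ⟨K, hK0, hK⟩ := exists_norm_iteratedFDeriv_newtonFar_scale_le (M + 1)
  refine ⟨K * 2 ^ (M + 2) / M.factorial, by positivity, fun x y hx hy => ?_⟩
  have hx0 : 0 < ‖x‖ := norm_pos_iff.2 hx
  set c : ℝ := ‖x‖ / 8 with hc
  have hc0 : 0 < c := by positivity
  set φ : EuclideanSpace ℝ (Fin 3) → ℝ := newtonFar (c * 1) (c * 2) with hφ_def
  have hφ : ContDiff ℝ ∞ φ := contDiff_newtonFar (by positivity) (by linarith)
  -- the bound on `D^{M+1}φ` along the segment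
  set D : ℝ := K * 2 ^ (M + 2) / ‖x‖ ^ (M + 2) with hD
  have hseg : ∀ s ∈ Icc (0 : ℝ) 1, ‖iteratedFDeriv ℝ (M + 1) φ (x - s • y)‖ ≤ D := by
    intro s hs
    have hz : ‖x‖ / 2 ≤ ‖x - s • y‖ := half_norm_le_norm_sub_smul hy hs
    have hz0 : 0 < ‖x - s • y‖ := by linarith
    have h1 := hK c hc0 (x - s • y) (by rw [hc]; linarith)
    refine h1.trans ?_
    rw [hD, show M + 1 + 1 = M + 2 by ring, div_le_div_iff₀ (pow_pos hz0 _) (pow_pos hx0 _)]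
    calc K * ‖x‖ ^ (M + 2) = K * (2 * (‖x‖ / 2)) ^ (M + 2) := by ring
      _ ≤ K * (2 * ‖x - s • y‖) ^ (M + 2) := by
          refine mul_le_mul_of_nonneg_left (pow_le_pow_left₀ (by positivity) (by linarith) _) hK0
      _ = K * 2 ^ (M + 2) * ‖x - s • y‖ ^ (M + 2) := by rw [mul_pow]; ring
  have hT := taylor_segment hφ M x y hseg
  -- `φ = Γ` at `x - y` and all `Dᵐφ(x) = DᵐΓ(x)`
  have hxy : ‖x‖ / 2 ≤ ‖x - y‖ := by
    have := half_norm_le_norm_sub_smul hy (right_mem_Icc.2 (zero_le_one (α := ℝ)))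
    rwa [one_smul] at this
  have e1 : φ (x - y) = newtonKernel (x - y) :=
    newtonFar_eq_newtonKernel (by positivity) (by linarith) (by rw [hc]; linarith)
  have e2 : ∀ m, iteratedFDeriv ℝ m φ x = iteratedFDeriv ℝ m newtonKernel x := fun m =>
    iteratedFDeriv_newtonFar_scale_eq hc0 (by rw [hc]; linarith) m
  simp only [e1, e2] at hT
  refine hT.trans (le_of_eq ?_)
  rw [hD]
  field_simp

/-! ### Registered sub-goal -/

/-- **Registered helper stub `stub_paintedLadderKernelTaylorTools`** of `stub_paintedLadderHigher` (crux
stmt-NavierStokesRegularity-11717, line `moment-conditioned-rellich`): all-orders bounds `‖DᵐΓ(z)‖ ≤ K_m/‖z‖^{m+1}`,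
Taylor's formula along segments for smooth functions on `ℝ³`, and the Taylor remainder of the Newtonian kernel about a
far point to every order. [folklore] -/
theorem stub_paintedLadderKernelTaylorTools :
    (∀ m : ℕ, ∃ K : ℝ, 0 ≤ K ∧ ∀ z : EuclideanSpace ℝ (Fin 3), z ≠ 0 → ‖iteratedFDeriv ℝ m newtonKernel z‖ ≤ K / ‖z‖ ^ (m + 1)) ∧ (∀ (φ : EuclideanSpace ℝ (Fin 3) → ℝ), ContDiff ℝ (⊤ : ℕ∞) φ → ∀ (M : ℕ) (x y : EuclideanSpace ℝ (Fin 3)) (D : ℝ), (∀ s ∈ Icc (0 : ℝ) 1, ‖iteratedFDeriv ℝ (M + 1) φ (x - s • y)‖ ≤ D) → |φ (x - y) - ∑ m ∈ Finset.range (M + 1), (-1 : ℝ) ^ m / m.factorial * iteratedFDeriv ℝ m φ x (fun _ => y)| ≤ D * ‖y‖ ^ (M + 1) / M.factorial) ∧ (∀ M : ℕ, ∃ C : ℝ, 0 ≤ C ∧ ∀ (x y : EuclideanSpace ℝ (Fin 3)), x ≠ 0 → ‖y‖ ≤ ‖x‖ / 2 → |newtonKernel (x - y) - ∑ m ∈ Finset.range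 (M + 1), (-1 : ℝ) ^ m / m.factorial * iteratedFDeriv ℝ m newtonKernel x (fun _ => y)| ≤ C * ‖y‖ ^ (M + 1) / ‖x‖ ^ (M + 2)) :=
  ⟨exists_norm_iteratedFDeriv_newtonKernel_le,
    fun _φ hφ M x y _D hD => taylor_segment hφ M x y hD,
    newtonKernel_taylor_remainder⟩

end Summit.NavierStokesRegularity.NavierStokesRegularity.Theorems.RellichScarScarRigidity

end
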